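import Literature.Topology.FourManifolds.CylinderToSphere
import Literature.Topology.FourManifolds.SchoenfliesBallForm
import Literature.Topology.FourManifolds.WhitneyModelSheets
import Literature.Topology.FourManifolds.FramedTubularNbhd
import Literature.Geometry.Manifold.SmoothEmbeddingInverse
import HarnessLib

/-!
# The conformal embedding `ℝ × Sⁿ ↪ Sⁿ⁺¹`: embedding properties, latitudes, polar caps

Sequel to `CylinderToSphere.lean` (the map `ι = CylinderToSphere.map n : ℝ × Sⁿ → Sⁿ⁺¹`,
`(t, p) ↦ (cos θ · p, sin θ)`, `θ = arctan t`), infrastructure for the fact seat of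
`Literature.Topology.FourManifolds.BudneyGabai2019_thm_3_13` (`NonSeparatingSpheres.lean`;
R. Budney, D. Gabai, *Knotted 3-balls in `S⁴`*, arXiv:1912.09029, Thm. 3.13).  The classical
argument for `n ≤ 2` straightens the lift of a non-separating sphere inside `Sⁿ⁺¹ ⊃ ℝ × Sⁿ` by
Schoenflies balls and Palais' disc theorem and reads the result back on the cylinder; this needs
`ι` as a *diffeomorphism onto the complement of the poles* and the dictionary between slabs of
the cylinder and polar caps of the sphere:

* `range_map` — `ι(ℝ × Sⁿ) = Sⁿ⁺¹ ∖ {N, S}` (`eq_pole_of_init_eq_zero`: the points over the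
  origin of `ℝⁿ⁺¹` are the poles);
* `isSmoothEmbedding_map` — `ι` is a smooth embedding (an injective local diffeomorphism —
  injective differential between manifolds of the same dimension, the tree's inverse function
  theorem `isLocalDiffeomorphAt_of_mfderiv_injective` — is a smooth embedding,
  `isSmoothEmbedding_of_isLocalDiffeomorph`), with open range; `exists_contMDiffOn_leftInverse`
  — hence a `C^∞` left inverse on its range (`Literature.Geometry.Manifold.contMDiffOn_invFun_range`);
* `inner_coe_map_northPole` — the latitude of `ι (t, p)` is `⟪ι (t, p), N⟫ = sin (arctan t)`,
  strictly increasing in `t` (`sin_arctan_lt_sin_arctan_iff`); hence the polar caps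
  `{⟪z, N⟫ ≤ sin (arctan a)} = ι ((-∞, a] × Sⁿ) ∪ {S}` and `{sin (arctan a) ≤ ⟪z, N⟫} =
  ι ([a, ∞) × Sⁿ) ∪ {N}` and their open and level versions (`setOf_inner_le_eq`, …);
* `exists_southCap_disc`, `exists_northCap_disc` — **the polar caps are smoothly embedded closed
  balls**: for every `a` there is a smooth embedding `c : ℝⁿ⁺¹ → Sⁿ⁺¹` (a scaled inverse
  stereographic projection) with `c 0` the pole, `c (𝔻) = ` the closed cap of latitude
  `sin (arctan a)`, `c (∂𝔻) = ` the latitude sphere `ι ({a} × Sⁿ)`, and range the complement of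
  the opposite pole.

Everything here is proved; no definition and no named fact is introduced.

## References

* R. Budney, D. Gabai, *Knotted 3-balls in `S⁴`*, arXiv:1912.09029 (v2), §3, Thm. 3.13.
  [BudneyGabai2019]
* M. W. Hirsch, *Differential Topology*, GTM 33 (1976), Ch. 1 §1–§3 (coordinates on spheres,
  embeddings). [HirschDT1976]
-/

noncomputable section

open scoped Manifold ContDiff Topology Real RealInnerProductSpace
open Set Function Metric Module

namespace Literature.Topology.FourManifolds

namespace CylinderToSphere

variable (n : ℕ)

local notation "𝔼 " k:arg => EuclideanSpace ℝ (Fin k)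
local notation "𝕊 " k:arg => (Metric.sphere (0 : EuclideanSpace ℝ (Fin (k + 1))) 1)

/-! ### The range: the complement of the poles -/

/-- A point of `Sⁿ⁺¹` over the origin of `ℝⁿ⁺¹` is one of the poles. [folklore] -/
theorem eq_pole_of_init_eq_zero {z : 𝕊 (n + 1)} (hz : init n (z : 𝔼 (n + 1 + 1)) = 0) :
    z = northPole n ∨ z = southPole n := by
  -- the last coordinate has square `1`
  have hnorm : ‖(z : 𝔼 (n + 1 + 1))‖ ^ 2 = 1 := by rw [norm_eq_of_mem_sphere z, one_pow]
  rw [EuclideanSpace.real_norm_sq_eq, Fin.sum_univ_castSucc] at hnorm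
  have hzero : ∀ j : Fin (n + 1), (z : 𝔼 (n + 1 + 1)) (Fin.castSucc j) = 0 := fun j ↦ by
    have := congrArg (fun w : 𝔼 (n + 1) ↦ w j) hz
    simpa [init_apply] using this
  simp only [hzero, ne_eq, OfNat.ofNat_ne_zero, not_false_eq_true, zero_pow, Finset.sum_const_zero,
    zero_add] at hnorm
  have hlast : (z : 𝔼 (n + 1 + 1)) (Fin.last (n + 1)) = 1 ∨
      (z : 𝔼 (n + 1 + 1)) (Fin.last (n + 1)) = -1 :=
    mul_self_eq_one_iff.1 (by rw [← pow_two]; exact hnorm)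
  rcases hlast with h | h
  · left
    apply Subtype.ext
    ext i
    induction i using Fin.lastCases with
    | last => simp [northPole, h]
    | cast j => simp [northPole, hzero j, (Fin.castSucc_lt_last j).ne]
  · right
    apply Subtype.ext
    ext i
    induction i using Fin.lastCases with
    | last => simp [southPole, h]
    | cast j => simp [southPole, hzero j, (Fin.castSucc_lt_last j).ne]

/-- **The range of `ι` is the complement of the two poles.** [folklore] -/
theorem range_map : range (map n) = ({northPole n, southPole n} : Set (𝕊 (n + 1)))ᶜ := by
  ext z
  simp only [mem_range, mem_compl_iff, mem_insert_iff, mem_singleton_iff, not_or]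
  constructor
  · rintro ⟨q, rfl⟩
    exact ⟨map_ne_northPole n q, map_ne_southPole n q⟩
  · rintro ⟨hN, hS⟩
    apply exists_map_eq_of_init_ne_zero
    intro h0
    rcases eq_pole_of_init_eq_zero n h0 with h | h
    · exact hN h
    · exact hS h

/-! ### `ι` is a smooth embedding with open range and smooth left inverse -/

/-- **`ι : ℝ × Sⁿ → Sⁿ⁺¹` is a smooth embedding.**  Its differential is injective everywhere
(`injective_mfderiv_map`) between manifolds of the same dimension `n + 1`, so `ι` is a local
diffeomorphism at every point (inverse function theorem,
`isLocalDiffeomorphAt_of_mfderiv_injective`); an injective local diffeomorphism is a smooth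
embedding (`isSmoothEmbedding_of_isLocalDiffeomorph`). [folklore] -/
theorem isSmoothEmbedding_map :
    Manifold.IsSmoothEmbedding (𝓘(ℝ, ℝ).prod (𝓡 n)) (𝓡 (n + 1)) ∞ (map n) := by
  have hdim : finrank ℝ (ℝ × 𝔼 n) = finrank ℝ (𝔼 (n + 1)) := by
    rw [finrank_prod, finrank_self, finrank_euclideanSpace_fin, finrank_euclideanSpace_fin]
    omega
  have hloc : IsLocalDiffeomorph (𝓘(ℝ, ℝ).prod (𝓡 n)) (𝓡 (n + 1)) ∞ (map n) := fun q ↦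
    isLocalDiffeomorphAt_of_mfderiv_injective isOpen_univ (mem_univ q)
      (contMDiff_map n).contMDiffOn (by simp) hdim (injective_mfderiv_map n q)
  exact isSmoothEmbedding_of_isLocalDiffeomorph hloc (injective_map n)
    (ContinuousLinearEquiv.ofFinrankEq hdim)

/-- The range of `ι` is open. [folklore] -/
theorem isOpen_range_map : IsOpen (range (map n)) := by
  rw [range_map]
  exact (Set.toFinite _).isClosed.isOpen_compl

/-- **A smooth left inverse of `ι` on its range** (the inverse of a smooth embedding is smooth on
the range, `Literature.Geometry.Manifold.contMDiffOn_invFun_range`). [folklore] -/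
theorem exists_contMDiffOn_leftInverse :
    ∃ u : 𝕊 (n + 1) → ℝ × 𝕊 n, ContMDiffOn (𝓡 (n + 1)) (𝓘(ℝ, ℝ).prod (𝓡 n)) ∞ u (range (map n)) ∧
      ∀ q, u (map n q) = q := by
  haveI : Nonempty (𝕊 n) := (NormedSpace.sphere_nonempty.2 zero_le_one).to_subtype
  exact ⟨invFun (map n), Literature.Geometry.Manifold.contMDiffOn_invFun_range
    (isSmoothEmbedding_map n), leftInverse_invFun (injective_map n)⟩

/-! ### Latitudes -/

/-- **The latitude of `ι (t, p)` is `sin (arctan t)`**: `⟪ι (t, p), N⟫ = sin (arctan t)`.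
[folklore] -/
theorem inner_coe_map_northPole (q : ℝ × 𝕊 n) :
    ⟪(map n q : 𝔼 (n + 1 + 1)), ((northPole n : 𝕊 (n + 1)) : 𝔼 (n + 1 + 1))⟫ =
      Real.sin (Real.arctan q.1) := by
  show ⟪(map n q : 𝔼 (n + 1 + 1)), EuclideanSpace.single (Fin.last (n + 1)) (1 : ℝ)⟫ = _
  rw [EuclideanSpace.inner_single_right, coe_map_apply_last]
  simp

/-- The latitude `t ↦ sin (arctan t)` is strictly increasing. [folklore] -/
theorem sin_arctan_lt_sin_arctan_iff {s t : ℝ} :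
    Real.sin (Real.arctan s) < Real.sin (Real.arctan t) ↔ s < t := by
  have hmono : StrictMono fun x : ℝ ↦ Real.sin (Real.arctan x) := fun a b hab ↦
    Real.strictMonoOn_sin ⟨(Real.neg_pi_div_two_lt_arctan a).le, (Real.arctan_lt_pi_div_two a).le⟩
      ⟨(Real.neg_pi_div_two_lt_arctan b).le, (Real.arctan_lt_pi_div_two b).le⟩
      (Real.arctan_strictMono hab)
  exact hmono.lt_iff_lt

/-- The latitude `t ↦ sin (arctan t)` is strictly increasing (non-strict form). [folklore] -/
theorem sin_arctan_le_sin_arctan_iff {s t : ℝ} :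
    Real.sin (Real.arctan s) ≤ Real.sin (Real.arctan t) ↔ s ≤ t := by
  rw [← not_lt, sin_arctan_lt_sin_arctan_iff, not_lt]

/-- The latitude `t ↦ sin (arctan t)` is injective. [folklore] -/
theorem sin_arctan_inj {s t : ℝ} :
    Real.sin (Real.arctan s) = Real.sin (Real.arctan t) ↔ s = t := by
  constructor
  · intro h
    exact le_antisymm (sin_arctan_le_sin_arctan_iff.1 h.le) (sin_arctan_le_sin_arctan_iff.1 h.ge)
  · rintro rfl
    rfl

/-- The latitude of the north pole is `1`. [folklore] -/
theorem inner_northPole_northPole :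
    ⟪((northPole n : 𝕊 (n + 1)) : 𝔼 (n + 1 + 1)), ((northPole n : 𝕊 (n + 1)) : 𝔼 (n + 1 + 1))⟫ =
      1 := by
  rw [real_inner_self_eq_norm_sq, norm_eq_of_mem_sphere]
  norm_num

/-- The latitude of the south pole is `-1`. [folklore] -/
theorem inner_southPole_northPole :
    ⟪((southPole n : 𝕊 (n + 1)) : 𝔼 (n + 1 + 1)), ((northPole n : 𝕊 (n + 1)) : 𝔼 (n + 1 + 1))⟫ =
      -1 := by
  show ⟪EuclideanSpace.single (Fin.last (n + 1)) (-1 : ℝ),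
    EuclideanSpace.single (Fin.last (n + 1)) (1 : ℝ)⟫ = _
  simp [EuclideanSpace.inner_single_left]

/-- Latitudes of points of `Sⁿ⁺¹` lie in `[-1, 1]`; the latitude `sin (arctan a)` lies strictly
inside. [folklore] -/
theorem sin_arctan_mem_Ioo (a : ℝ) : Real.sin (Real.arctan a) ∈ Ioo (-1 : ℝ) 1 := by
  have h1 : -(π / 2) < Real.arctan a := Real.neg_pi_div_two_lt_arctan a
  have h2 : Real.arctan a < π / 2 := Real.arctan_lt_pi_div_two a
  constructor
  · have h3 : Real.sin (-(π / 2)) = -1 := by rw [Real.sin_neg, Real.sin_pi_div_two]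
    rw [← h3]
    exact Real.strictMonoOn_sin ⟨le_rfl, by linarith [Real.pi_pos]⟩ ⟨h1.le, h2.le⟩ h1
  · rw [← Real.sin_pi_div_two]
    exact Real.strictMonoOn_sin ⟨h1.le, h2.le⟩ ⟨by linarith [Real.pi_pos], le_rfl⟩ h2


/-! ### Polar caps and latitude spheres in terms of `ι` -/

/-- **The closed south cap of latitude `sin (arctan a)` is `ι ((-∞, a] × Sⁿ) ∪ {S}`.**
[folklore] -/
theorem setOf_inner_le_eq (a : ℝ) :
    {z : 𝕊 (n + 1) | ⟪(z : 𝔼 (n + 1 + 1)), ((northPole n : 𝕊 (n + 1)) : 𝔼 (n + 1 + 1))⟫ ≤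
      Real.sin (Real.arctan a)} = map n '' {p | p.1 ≤ a} ∪ {southPole n} := by
  have hκ := sin_arctan_mem_Ioo a
  ext z
  simp only [mem_setOf_eq, mem_union, mem_image, mem_singleton_iff]
  constructor
  · intro hz
    by_cases hS : z = southPole n
    · exact Or.inr hS
    · have hN : z ≠ northPole n := by
        rintro rfl
        rw [inner_northPole_northPole] at hz
        linarith [hκ.2]
      obtain ⟨q, rfl⟩ : z ∈ range (map n) := by
        rw [range_map]; simp [hN, hS]
      rw [inner_coe_map_northPole, sin_arctan_le_sin_arctan_iff] at hz
      exact Or.inl ⟨q, hz, rfl⟩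
  · rintro (⟨q, hq, rfl⟩ | rfl)
    · rw [inner_coe_map_northPole, sin_arctan_le_sin_arctan_iff]; exact hq
    · rw [inner_southPole_northPole]; linarith [hκ.1]

/-- The open south cap `{⟪z, N⟫ < sin (arctan a)}` is `ι ((-∞, a) × Sⁿ) ∪ {S}`. [folklore] -/
theorem setOf_inner_lt_eq (a : ℝ) :
    {z : 𝕊 (n + 1) | ⟪(z : 𝔼 (n + 1 + 1)), ((northPole n : 𝕊 (n + 1)) : 𝔼 (n + 1 + 1))⟫ <
      Real.sin (Real.arctan a)} = map n '' {p | p.1 < a} ∪ {southPole n} := by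
  have hκ := sin_arctan_mem_Ioo a
  ext z
  simp only [mem_setOf_eq, mem_union, mem_image, mem_singleton_iff]
  constructor
  · intro hz
    by_cases hS : z = southPole n
    · exact Or.inr hS
    · have hN : z ≠ northPole n := by
        rintro rfl
        rw [inner_northPole_northPole] at hz
        linarith [hκ.2]
      obtain ⟨q, rfl⟩ : z ∈ range (map n) := by
        rw [range_map]; simp [hN, hS]
      rw [inner_coe_map_northPole, sin_arctan_lt_sin_arctan_iff] at hz
      exact Or.inl ⟨q, hz, rfl⟩
  · rintro (⟨q, hq, rfl⟩ | rfl)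
    · rw [inner_coe_map_northPole, sin_arctan_lt_sin_arctan_iff]; exact hq
    · rw [inner_southPole_northPole]; linarith [hκ.1]

/-- **The closed north cap of latitude `sin (arctan a)` is `ι ([a, ∞) × Sⁿ) ∪ {N}`.**
[folklore] -/
theorem setOf_le_inner_eq (a : ℝ) :
    {z : 𝕊 (n + 1) | Real.sin (Real.arctan a) ≤
      ⟪(z : 𝔼 (n + 1 + 1)), ((northPole n : 𝕊 (n + 1)) : 𝔼 (n + 1 + 1))⟫} =
      map n '' {p | a ≤ p.1} ∪ {northPole n} := by
  have hκ := sin_arctan_mem_Ioo a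
  ext z
  simp only [mem_setOf_eq, mem_union, mem_image, mem_singleton_iff]
  constructor
  · intro hz
    by_cases hN : z = northPole n
    · exact Or.inr hN
    · have hS : z ≠ southPole n := by
        rintro rfl
        rw [inner_southPole_northPole] at hz
        linarith [hκ.1]
      obtain ⟨q, rfl⟩ : z ∈ range (map n) := by
        rw [range_map]; simp [hN, hS]
      rw [inner_coe_map_northPole, sin_arctan_le_sin_arctan_iff] at hz
      exact Or.inl ⟨q, hz, rfl⟩
  · rintro (⟨q, hq, rfl⟩ | rfl)
    · rw [inner_coe_map_northPole, sin_arctan_le_sin_arctan_iff]; exact hq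
    · rw [inner_northPole_northPole]; linarith [hκ.2]

/-- The open north cap `{sin (arctan a) < ⟪z, N⟫}` is `ι ((a, ∞) × Sⁿ) ∪ {N}`. [folklore] -/
theorem setOf_lt_inner_eq (a : ℝ) :
    {z : 𝕊 (n + 1) | Real.sin (Real.arctan a) <
      ⟪(z : 𝔼 (n + 1 + 1)), ((northPole n : 𝕊 (n + 1)) : 𝔼 (n + 1 + 1))⟫} =
      map n '' {p | a < p.1} ∪ {northPole n} := by
  have hκ := sin_arctan_mem_Ioo a
  ext z
  simp only [mem_setOf_eq, mem_union, mem_image, mem_singleton_iff]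
  constructor
  · intro hz
    by_cases hN : z = northPole n
    · exact Or.inr hN
    · have hS : z ≠ southPole n := by
        rintro rfl
        rw [inner_southPole_northPole] at hz
        linarith [hκ.1]
      obtain ⟨q, rfl⟩ : z ∈ range (map n) := by
        rw [range_map]; simp [hN, hS]
      rw [inner_coe_map_northPole, sin_arctan_lt_sin_arctan_iff] at hz
      exact Or.inl ⟨q, hz, rfl⟩
  · rintro (⟨q, hq, rfl⟩ | rfl)
    · rw [inner_coe_map_northPole, sin_arctan_lt_sin_arctan_iff]; exact hq
    · rw [inner_northPole_northPole]; linarith [hκ.2]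

/-- **The latitude sphere `{⟪z, N⟫ = sin (arctan a)}` is `ι ({a} × Sⁿ)`.** [folklore] -/
theorem setOf_inner_eq_eq (a : ℝ) :
    {z : 𝕊 (n + 1) | ⟪(z : 𝔼 (n + 1 + 1)), ((northPole n : 𝕊 (n + 1)) : 𝔼 (n + 1 + 1))⟫ =
      Real.sin (Real.arctan a)} = map n '' {p | p.1 = a} := by
  have hκ := sin_arctan_mem_Ioo a
  ext z
  simp only [mem_setOf_eq, mem_image]
  constructor
  · intro hz
    have hN : z ≠ northPole n := by
      rintro rfl
      rw [inner_northPole_northPole] at hz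
      linarith [hκ.2]
    have hS : z ≠ southPole n := by
      rintro rfl
      rw [inner_southPole_northPole] at hz
      linarith [hκ.1]
    obtain ⟨q, rfl⟩ : z ∈ range (map n) := by
      rw [range_map]; simp [hN, hS]
    rw [inner_coe_map_northPole, sin_arctan_inj] at hz
    exact ⟨q, hz, rfl⟩
  · rintro ⟨q, hq, rfl⟩
    rw [inner_coe_map_northPole, sin_arctan_inj]
    exact hq

/-! ### The polar caps are smoothly embedded balls -/

section Caps

variable {V : Type*} [NormedAddCommGroup V] [InnerProductSpace ℝ V] {m : ℕ}
  [Fact (finrank ℝ V = m + 1)]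

/-- The inverse stereographic projection carries the closed ball of radius `r` onto the closed
cap `{p | ⟪p, v⟫ ≤ (r² − 4)/(r² + 4)}` around the antipode `-v` (Mathlib's normalisation,
`real_inner_stereographic'_symm_pole`). [folklore] -/
theorem image_stereographic'_symm_closedBall (v : sphere (0 : V) 1) {r : ℝ} (hr : 0 ≤ r) :
    (stereographic' m v).symm '' closedBall (0 : EuclideanSpace ℝ (Fin m)) r =
      {p : sphere (0 : V) 1 | ⟪(p : V), (v : V)⟫ ≤ (r ^ 2 - 4) / (r ^ 2 + 4)} := by
  have hmono : ∀ {s s' : ℝ}, 0 ≤ s → 0 ≤ s' →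
      ((s ^ 2 - 4) / (s ^ 2 + 4) ≤ (s' ^ 2 - 4) / (s' ^ 2 + 4) ↔ s ≤ s') := by
    intro s s' hs hs'
    rw [div_le_div_iff₀ (by positivity) (by positivity)]
    constructor
    · intro h
      nlinarith
    · intro h
      nlinarith [mul_le_mul h h hs (hs.trans h)]
  ext p
  simp only [mem_image, mem_closedBall_zero_iff, mem_setOf_eq]
  constructor
  · rintro ⟨x, hx, rfl⟩
    rw [real_inner_stereographic'_symm_pole]
    exact (hmono (norm_nonneg x) hr).2 hx
  · intro hp
    have hr4 : (r ^ 2 - 4) / (r ^ 2 + 4) < 1 := by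
      rw [div_lt_one (by positivity)]; linarith
    have hpv : p ≠ v := by
      rintro rfl
      have h1 : ⟪(p : V), (p : V)⟫ = 1 := by
        rw [real_inner_self_eq_norm_sq, norm_eq_of_mem_sphere]; norm_num
      rw [h1] at hp
      linarith
    refine ⟨stereographic' m v p, ?_, stereographic'_symm_apply_of_ne v hpv⟩
    have h := real_inner_stereographic'_symm_pole (n := m) v (stereographic' m v p)
    rw [stereographic'_symm_apply_of_ne v hpv] at h
    rw [h] at hp
    exact (hmono (norm_nonneg _) hr).1 hp

/-- The scaled inverse stereographic projection `y ↦ σᵥ⁻¹ (c y)`, `c ≠ 0`, is a smooth embedding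
`ℝᵐ → S`. [folklore] -/
theorem isSmoothEmbedding_stereographic'_symm_comp_smul (v : sphere (0 : V) 1) {c : ℝ}
    (hc : c ≠ 0) :
    Manifold.IsSmoothEmbedding (𝓡 m) (𝓡 m) ∞
      ((stereographic' m v).symm ∘ fun y : EuclideanSpace ℝ (Fin m) ↦ c • y) :=
  (isSmoothEmbedding_stereographic'_symm v).comp_openPartialHomeomorph
    (Homeomorph.smulOfNeZero c hc).toOpenPartialHomeomorph rfl
    (contDiff_const_smul c).contMDiff.contMDiffOn
    (contDiff_const_smul c⁻¹).contMDiff.contMDiffOn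

/-- **Every closed cap `{p | ⟪p, v⟫ ≤ κ}`, `-1 < κ < 1`, is a smoothly embedded closed ball**
centred at `-v`, bounded by the latitude sphere `{⟪p, v⟫ = κ}`, the embedding of `ℝᵐ` having
range `S ∖ {v}` (a scaled inverse stereographic projection from `v`). [folklore] -/
theorem exists_cap_disc (v : sphere (0 : V) 1) {κ : ℝ} (hκ : κ ∈ Ioo (-1 : ℝ) 1) :
    ∃ c : EuclideanSpace ℝ (Fin m) → sphere (0 : V) 1,
      Manifold.IsSmoothEmbedding (𝓡 m) (𝓡 m) ∞ c ∧ ((c 0 : sphere (0 : V) 1) : V) = -(v : V) ∧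
      c '' closedBall 0 1 = {p : sphere (0 : V) 1 | ⟪(p : V), (v : V)⟫ ≤ κ} ∧
      c '' sphere 0 1 = {p : sphere (0 : V) 1 | ⟪(p : V), (v : V)⟫ = κ} ∧ range c = {v}ᶜ := by
  set l : ℝ := 2 * Real.sqrt ((1 + κ) / (1 - κ)) with hl
  have h1κ : 0 < 1 - κ := by linarith [hκ.2]
  have h1κ' : 0 < 1 + κ := by linarith [hκ.1]
  have hlpos : 0 < l := by positivity
  have hlsq : l ^ 2 = 4 * ((1 + κ) / (1 - κ)) := by
    rw [hl, mul_pow, Real.sq_sqrt (by positivity)]; norm_num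
  have hlκ : (l ^ 2 - 4) / (l ^ 2 + 4) = κ := by
    rw [hlsq, div_eq_iff (by positivity)]
    field_simp
    ring
  refine ⟨(stereographic' m v).symm ∘ fun y ↦ l • y,
    isSmoothEmbedding_stereographic'_symm_comp_smul v hlpos.ne', ?_, ?_, ?_, ?_⟩
  · simp only [comp_apply, smul_zero]
    exact coe_stereographic'_symm_zero v
  · rw [image_comp, image_smul, smul_closedBall' hlpos.ne', smul_zero, Real.norm_of_nonneg hlpos.le,
      mul_one, image_stereographic'_symm_closedBall v hlpos.le, hlκ]
  · rw [image_comp, image_smul, smul_sphere' hlpos.ne', smul_zero, Real.norm_of_nonneg hlpos.le,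
      mul_one, image_stereographic'_symm_sphere v hlpos.le, hlκ]
  · rw [range_comp]
    have : range (fun y : EuclideanSpace ℝ (Fin m) ↦ l • y) = univ :=
      (Homeomorph.smulOfNeZero l hlpos.ne').surjective.range_eq
    rw [this, ← stereographic'_target v, (stereographic' m v).symm_image_target_eq_source,
      stereographic'_source]

end Caps

end CylinderToSphere

end Literature.Topology.FourManifolds

end
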